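import Literature.Combinatorics.Optimization.ShellLawMixedPinning
import HarnessLib

/-!
# Pinned sub-sums are sub-sums: a weighted section on a two-edge-deleted ground set is dominated by the one on
# the full ground set

Continuation of `ShellLawMixedPinning.lean` (§1 `sum_shell_pin_one_eq_fun`: the sum of an arbitrary function of the cut
over the cuts of `Shell_S(t+2,c)` containing a given full edge `e_v` is the sum over `Shell_{S∖e_v}(t,c)` of the function
at `W ∪ e_v`). Fix a fixed-point-free involution `π` (a perfect matching), a `π`-stable ground set `S`, a block `H` and two
distinct edges `e_v, e_w` of `S`. Re-inserting `e_w` FULL (and leaving `e_v` untouched) embeds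
`Shell_{S∖e_v∖e_w}(t,c)` into `Shell_S(t+2,c)`; for a NONNEGATIVE function of the cut the sum over the image is at most the
full sum:

* §1 `shellIn_mono` (shells are monotone in the ground set), **`sum_shellIn_del2_union_le`**:
  `Σ_{W ∈ Shell_{S∖e_v∖e_w}(t,c)} F(W ∪ e_w) ≤ Σ_{U ∈ Shell_S(t+2,c)} F(U)` for `F ≥ 0`.
* §2 bookkeeping for the re-inserted edge when it is NOT an `HH` edge: the block statistic shifts by `|e_w ∩ H|` and the
  number `n_A` of `HH` edges inside the cut is unchanged (`hhFilter_union_pair_eq`).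
* §3 **`weightedSection_del2_le`** / **`weightedSection_del2_le_ratio_mul`**: for a weight `w ≥ 0` on `n_A` and `e_w` not of
  type `HH`,
  `Σ_{W ∈ Shell_{S∖e_v∖e_w}(t,c), |W∩H| = y} w(n_A(W)) ≤ Σ_{U ∈ Shell_S(t+2,c), |U∩H| = y+|e_w∩H|} w(n_A(U))`, and, divided by the
  shell sizes (`card_shellIn_del2_ratio`: `|S|(|S|−2)·|Shell_{S∖2e}(t,c)| = (t+2−c)(|S|−t−2−c)·|Shell_S(t+2,c)|`),
  `P^w_{S∖e_v∖e_w}(t,c; y) ≤ (|S|(|S|−2)/((t+2−c)(|S|−t−2−c)))·P^w_S(t+2,c; y+|e_w∩H|)`.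

All PROVED, 0 sorry, no definitions, no named facts. Cell pnp-psdrank (prover g27, MEMO-30 §2 (B3c)): with `w(α) = (α − m)²`
this compares the centred second moment of the level-step-deleted ground sets `S∖e_p∖e_q` of `main_one_eq`
(`ShellLawCentredMomentLevelStep`) with the one on `S` at the reference point of `abs_nab2_iter_weightedSection_one_le`
(`ShellLawWeightedPointwiseMixture` §7) — no conditional-mean or variance-ceiling comparability is needed. Nothing here is about
psd rank or P vs NP.

## References
* [Rothvoss2017] T. Rothvoß, *The matching polytope has exponential extension complexity*, J. ACM 64 (2017), §2
  (PDF pp. 5–6): cuts, perfect matchings, the three edge types, the level classes.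
* [GodsilMeagher2015] C. Godsil, K. Meagher, *Erdős–Ko–Rado Theorems: Algebraic Approaches*, §15.2 (perfect matchings as
  fixed-point-free involutions; edge representatives).
-/

noncomputable section

open Finset

namespace Literature.Combinatorics.Optimization

namespace ShellStep

variable {n : ℕ} {π : Fin n → Fin n}

/-! ### §1 Shells are monotone in the ground set; pinned sub-sums are sub-sums -/

/-- Shells are monotone in the ground set: `S′ ⊆ S ⇒ Shell_{S′}(t,c) ⊆ Shell_S(t,c)`. [cite: Rothvoss2017, §2 (PDF p. 6)] -/
theorem shellIn_mono {S' S : Finset (Fin n)} (h : S' ⊆ S) (t c : ℕ) : shellIn π S' t c ⊆ shellIn π S t c := by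
  intro U hU
  rw [mem_shellIn] at hU ⊢
  exact ⟨hU.1.trans h, hU.2.1, hU.2.2⟩

section Pin

variable (hπ : ∀ v, π (π v) = v) (hπ' : ∀ v, π v ≠ v)
include hπ hπ'

/-- **Pinned sub-sums are sub-sums.** For two edges `e_v ≠ e_w` of the `π`-stable `S` and a function `F ≥ 0` on
`Shell_S(t+2,c)`: `Σ_{W ∈ Shell_{S∖e_v∖e_w}(t,c)} F(W ∪ e_w) ≤ Σ_{U ∈ Shell_S(t+2,c)} F(U)` — the cuts `W ∪ e_w` are exactly the
members of `Shell_{S∖e_v}(t+2,c)` containing `e_w` (`sum_shell_pin_one_eq_fun`), a subset of `Shell_S(t+2,c)`.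
[cite: Rothvoss2017, §2 (PDF p. 6)] [cite: GodsilMeagher2015, §15.2] -/
theorem sum_shellIn_del2_union_le {S : Finset (Fin n)} (hS : ∀ u ∈ S, π u ∈ S) {v w : Fin n} (hw : w ∈ S)
    (hwv : w ≠ v) (hwπ : w ≠ π v) (t c : ℕ) (F : Finset (Fin n) → ℝ) (hF : ∀ U ∈ shellIn π S (t + 2) c, 0 ≤ F U) :
    ∑ W ∈ shellIn π (del2 π S v w) t c, F (W ∪ {w, π w}) ≤ ∑ U ∈ shellIn π S (t + 2) c, F U := by
  have hw' : w ∈ S \ {v, π v} := by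
    rw [mem_sdiff, mem_insert, mem_singleton, not_or]
    exact ⟨hw, hwv, hwπ⟩
  rw [del2_eq_sdiff_sdiff, ← sum_shell_pin_one_eq_fun hπ hπ' (sdiff_pair_stable hπ hS v) hw' t c F]
  calc ∑ U ∈ (shellIn π (S \ {v, π v}) (t + 2) c).filter (fun U => w ∈ U ∧ π w ∈ U), F U
      ≤ ∑ U ∈ shellIn π (S \ {v, π v}) (t + 2) c, F U :=
        sum_le_sum_of_subset_of_nonneg (filter_subset _ _) fun U hU _ => hF U (shellIn_mono sdiff_subset _ _ hU)
    _ ≤ ∑ U ∈ shellIn π S (t + 2) c, F U :=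
        sum_le_sum_of_subset_of_nonneg (shellIn_mono sdiff_subset _ _) fun U hU _ => hF U hU

/-! ### §2 Bookkeeping for a re-inserted edge that is not of type `HH` -/

omit hπ' in
/-- Re-inserting a full edge `e_w` that is NOT an `HH` edge does not change the set of `HH` edges inside the cut: for
`W ⊆ S∖e_v∖e_w`, `{u ∈ reps(vAA_π(S,H)) : u, πu ∈ W ∪ e_w} = {u ∈ reps(vAA_π(S∖e_v∖e_w,H)) : u, πu ∈ W}`.
[cite: Rothvoss2017, §2 (PDF p. 5)] -/
theorem hhFilter_union_pair_eq {S H W : Finset (Fin n)} {v w : Fin n} (hwH : ¬(w ∈ H ∧ π w ∈ H))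
    (hW : W ⊆ del2 π S v w) :
    ((reps π (vAA π S H)).filter fun u => u ∈ W ∪ {w, π w} ∧ π u ∈ W ∪ {w, π w}) =
      ((reps π (vAA π (del2 π S v w) H)).filter fun u => u ∈ W ∧ π u ∈ W) := by
  ext u
  simp only [mem_filter, mem_reps, mem_vAA, mem_union, mem_insert, mem_singleton]
  constructor
  · rintro ⟨⟨⟨huS, huH, hπuH⟩, hlt⟩, hu, hπu⟩
    -- `u` is on an `HH` edge, so neither `u` nor `π u` is on `e_w`
    have hu' : u ∈ W := by
      rcases hu with hu | rfl | hu
      · exact hu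
      · exact absurd ⟨huH, hπuH⟩ hwH
      · subst hu; rw [hπ] at hπuH; exact absurd ⟨hπuH, huH⟩ hwH
    have hπu' : π u ∈ W := by
      rcases hπu with hπu | h | h
      · exact hπu
      · rw [(π_eq_iff hπ).1 h, hπ] at hπuH
        rw [(π_eq_iff hπ).1 h] at huH
        exact absurd ⟨hπuH, huH⟩ hwH
      · have := π_injective hπ h
        subst this
        exact absurd ⟨huH, hπuH⟩ hwH
    exact ⟨⟨⟨hW hu', huH, hπuH⟩, hlt⟩, hu', hπu'⟩
  · rintro ⟨⟨⟨hud, huH, hπuH⟩, hlt⟩, hu, hπu⟩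
    exact ⟨⟨⟨(mem_del2.1 hud).1, huH, hπuH⟩, hlt⟩, Or.inl hu, Or.inl hπu⟩

/-! ### §3 The comparability of weighted sections -/

/-- **A weighted section of a two-edge-deleted ground set is a pinned sub-sum of the one on `S`.** For distinct edges
`e_v, e_w` of the `π`-stable `S` with `e_w` NOT of type `HH`, a weight `w ≥ 0` on the number `n_A` of `HH` edges inside the cut,
and a point `y`:
`Σ_{W ∈ Shell_{S∖e_v∖e_w}(t,c), |W∩H| = y} w(n_A(W)) ≤ Σ_{U ∈ Shell_S(t+2,c), |U∩H| = y + |e_w∩H|} w(n_A(U))`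
(`n_A` counted in the respective ground set). [cite: Rothvoss2017, §2 (PDF p. 6)] [cite: GodsilMeagher2015, §15.2] -/
theorem weightedSection_del2_le {S : Finset (Fin n)} (hS : ∀ u ∈ S, π u ∈ S) (H : Finset (Fin n)) {v w : Fin n}
    (hw : w ∈ S) (hwv : w ≠ v) (hwπ : w ≠ π v) (hwH : ¬(w ∈ H ∧ π w ∈ H)) (t c : ℕ) (wt : ℕ → ℝ)
    (hwt : ∀ α, 0 ≤ wt α) (y : ℤ) :
    ∑ W ∈ ((shellIn π (del2 π S v w) t c).filter fun W => ((W ∩ H).card : ℤ) = y),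
        wt ((reps π (vAA π (del2 π S v w) H)).filter fun u => u ∈ W ∧ π u ∈ W).card ≤
      ∑ U ∈ ((shellIn π S (t + 2) c).filter fun U => ((U ∩ H).card : ℤ) = y + (({w, π w} ∩ H).card : ℤ)),
        wt ((reps π (vAA π S H)).filter fun u => u ∈ U ∧ π u ∈ U).card := by
  classical
  -- both sides as indicator sums of one nonnegative function of the cut
  obtain ⟨F, hF⟩ : ∃ F : Finset (Fin n) → ℝ, ∀ U, F U =
      (if ((U ∩ H).card : ℤ) = y + (({w, π w} ∩ H).card : ℤ) then 1 else 0) *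
        wt ((reps π (vAA π S H)).filter fun u => u ∈ U ∧ π u ∈ U).card := ⟨_, fun _ => rfl⟩
  have hF0 : ∀ U ∈ shellIn π S (t + 2) c, 0 ≤ F U := fun U _ => by
    rw [hF]; exact mul_nonneg (by split_ifs <;> norm_num) (hwt _)
  have hR : ∑ U ∈ ((shellIn π S (t + 2) c).filter fun U => ((U ∩ H).card : ℤ) = y + (({w, π w} ∩ H).card : ℤ)),
      wt ((reps π (vAA π S H)).filter fun u => u ∈ U ∧ π u ∈ U).card = ∑ U ∈ shellIn π S (t + 2) c, F U := by
    rw [sum_filter]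
    refine sum_congr rfl fun U _ => ?_
    rw [hF]
    split_ifs <;> simp
  have hL : ∑ W ∈ ((shellIn π (del2 π S v w) t c).filter fun W => ((W ∩ H).card : ℤ) = y),
      wt ((reps π (vAA π (del2 π S v w) H)).filter fun u => u ∈ W ∧ π u ∈ W).card =
      ∑ W ∈ shellIn π (del2 π S v w) t c, F (W ∪ {w, π w}) := by
    rw [sum_filter]
    refine sum_congr rfl fun W hW => ?_
    have hWd : W ⊆ del2 π S v w := (mem_shellIn.1 hW).1
    have hwW : w ∉ W := fun h => (mem_del2.1 (hWd h)).2.2.2.1 rfl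
    have hπwW : π w ∉ W := fun h => (mem_del2.1 (hWd h)).2.2.2.2 rfl
    rw [hF, card_inter_union_pair hwW hπwW H, hhFilter_union_pair_eq hπ hwH hWd]
    by_cases h : ((W ∩ H).card : ℤ) = y
    · rw [if_pos h, if_pos (by rw [h]), one_mul]
    · rw [if_neg h, if_neg (fun e => h (by linarith)), zero_mul]
  rw [hL, hR]
  exact sum_shellIn_del2_union_le hπ hπ' hS hw hwv hwπ t c F hF0

/-- **The comparability, normalised.** Under the hypotheses of `weightedSection_del2_le`, with `e_v ⊆ S` as well and
`(t+2−c)(|S|−t−2−c) > 0` (a nonempty two-edge-deleted shell):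
`P^w_{S∖e_v∖e_w}(t,c; y) ≤ (|S|(|S|−2)/((t+2−c)(|S|−t−2−c)))·P^w_S(t+2,c; y+|e_w∩H|)`,
`P^w_{S′}(t′,c;y) = (Σ_{W ∈ Shell_{S′}(t′,c), |W∩H| = y} w(n_A(W)))/|Shell_{S′}(t′,c)|` (the two-edge size ratio
`card_shellIn_del2_ratio`). [cite: Rothvoss2017, §2 (PDF p. 6)] [cite: GodsilMeagher2015, §15.2] -/
theorem weightedSection_del2_le_ratio_mul {S : Finset (Fin n)} (hS : ∀ u ∈ S, π u ∈ S) (H : Finset (Fin n))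
    {v w : Fin n} (hv : v ∈ S) (hw : w ∈ S) (hwv : w ≠ v) (hwπ : w ≠ π v) (hwH : ¬(w ∈ H ∧ π w ∈ H)) (t c : ℕ)
    (hpos : 0 < ((t : ℝ) + 2 - c) * ((S.card : ℝ) - (t + 2) - c)) (wt : ℕ → ℝ) (hwt : ∀ α, 0 ≤ wt α) (y : ℤ) :
    (∑ W ∈ ((shellIn π (del2 π S v w) t c).filter fun W => ((W ∩ H).card : ℤ) = y),
        wt ((reps π (vAA π (del2 π S v w) H)).filter fun u => u ∈ W ∧ π u ∈ W).card) /
        ((shellIn π (del2 π S v w) t c).card : ℝ) ≤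
      ((S.card : ℝ) * ((S.card : ℝ) - 2) / (((t : ℝ) + 2 - c) * ((S.card : ℝ) - (t + 2) - c))) *
        ((∑ U ∈ ((shellIn π S (t + 2) c).filter fun U => ((U ∩ H).card : ℤ) = y + (({w, π w} ∩ H).card : ℤ)),
          wt ((reps π (vAA π S H)).filter fun u => u ∈ U ∧ π u ∈ U).card) / ((shellIn π S (t + 2) c).card : ℝ)) := by
  have hle := weightedSection_del2_le hπ hπ' hS H hw hwv hwπ hwH t c wt hwt y
  have hratio := card_shellIn_del2_ratio hπ hπ' hS hv hw hwv hwπ t c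
  obtain ⟨R, hR⟩ : ∃ R : ℝ, R = ∑ U ∈ ((shellIn π S (t + 2) c).filter fun U =>
      ((U ∩ H).card : ℤ) = y + (({w, π w} ∩ H).card : ℤ)),
      wt ((reps π (vAA π S H)).filter fun u => u ∈ U ∧ π u ∈ U).card := ⟨_, rfl⟩
  rw [← hR] at hle ⊢
  have h4 : 4 ≤ S.card := by have := card_del2_add_four hπ hπ' hS hv hw hwv hwπ; omega
  have hM : (0 : ℝ) < (S.card : ℝ) * ((S.card : ℝ) - 2) := by
    have : (4 : ℝ) ≤ S.card := by exact_mod_cast h4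
    exact mul_pos (by linarith) (by linarith)
  by_cases h0 : (shellIn π (del2 π S v w) t c).card = 0
  · -- then the shell of `S` is empty as well, and both sides vanish
    have hA0 : ((shellIn π S (t + 2) c).card : ℝ) = 0 := by
      have h := hratio
      rw [h0, Nat.cast_zero, mul_zero] at h
      rcases mul_eq_zero.1 h.symm with hQ | hA
      · exact absurd hQ hpos.ne'
      · exact hA
    rw [h0, Nat.cast_zero, div_zero, hA0, div_zero, mul_zero]
  have hD : (0 : ℝ) < ((shellIn π (del2 π S v w) t c).card : ℝ) := by exact_mod_cast Nat.pos_of_ne_zero h0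
  have hA : (0 : ℝ) < ((shellIn π S (t + 2) c).card : ℝ) := by
    have h : 0 < ((t : ℝ) + 2 - c) * ((S.card : ℝ) - (t + 2) - c) * ((shellIn π S (t + 2) c).card : ℝ) := by
      rw [← hratio]; exact mul_pos hM hD
    exact pos_of_mul_pos_right h hpos.le
  calc _ ≤ R / ((shellIn π (del2 π S v w) t c).card : ℝ) := div_le_div_of_nonneg_right hle hD.le
    _ = _ := by
        rw [div_mul_div_comm, div_eq_div_iff hD.ne' (mul_ne_zero hpos.ne' hA.ne')]
        linear_combination (-R) * hratio

end Pin

end ShellStep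

end Literature.Combinatorics.Optimization

end
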